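import Literature.NumberTheory.ComplexMultiplication.CMTypeRankIrreducibleSlot
import Literature.NumberTheory.ComplexMultiplication.SharedImaginaryQuadraticDegenerate
import Summits.HodgeConjecture.CorCM.PairwiseCMFamiliesHodge
import Summits.HodgeConjecture.CorCM.GaloisSexticThreefoldPairsHodge
import HarnessLib

/-!
# A CM abelian threefold whose sextic CM field has pair flips (Galois closure of degree `24` or `48`) TIMES a CM abelian
# variety of dimension `≤ 2`, or a CM threefold whose field contains an imaginary quadratic field: `Hg(A₀ × A₁) =
# Hg(A₀) × Hg(A₁)`, and the Hodge conjecture on every `A₀^a × A₁^b`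

COR-CM (cell `pub-hodgecm2`, binder seat `b16` gen 41, count-neutral claim CM33-PAIRFLIP, file F2; theorems only, no
definition, no named fact).  NEW as stated (pairs of CM abelian varieties with DIFFERENT CM fields, one of them a
"generic" sextic field), hence under `Summits/`.  The geometric face of
`Literature/NumberTheory/ComplexMultiplication/CMTypeRankIrreducibleSlot`:

SETTING.  `K_{i₁}` a sextic CM field with PAIR FLIPS — every conjugate pair of complex embeddings is exchanged by an
automorphism of `ℂ` fixing the other four; by `CorCM/SexticCMFieldPairFlip` this holds whenever the Galois closure of
`K_{i₁}` has degree `24` or `48` (Dodson's sextic CM fields without imaginary quadratic subfield; the field class of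
the period programme's stage 1).  Then `U(Φ_{i₁}) = Anti` is an IRREDUCIBLE three-dimensional `Aut(ℂ)`-module for
every type `Φ_{i₁}` (`antiSpan_irreducible_of_pairFlip`).  The partner `K_{i₀}` is

* (a) ANY CM field of degree `≤ 4` (`dim U(Φ_{i₀}) ≤ 2 < 3`), or
* (b) a sextic CM field receiving an imaginary quadratic field `k ↪ K_{i₀}` (cyclic sextics `k·C`, the non-Galois
  `K⁺·k` with closure of degree `12`): the `k`-sign vector `φ ↦ ±1` is an `Aut(ℂ)`-eigenvector in the odd weights, a
  proper stable line (`exists_proper_stable_of_eigenvector`).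

In both cases the pair has NO COMMON CONSTITUENT (`pairwise_of_irreducible_of_finrank_le`), so (§1)
**`isNondegenerateFamily_iff_pairFlipSextic_of_finrank_le_four`**, **`…_of_quadratic`**: the family `(Φ_{i₀}, Φ_{i₁})`
is nondegenerate — `Hg(A₀ × A₁) = Hg(A₀) × Hg(A₁)`, `B• = D•` on all `A₀^a × A₁^b` — **iff `Φ_{i₀}` is nondegenerate**,
with NO condition relating the two fields (no linear disjointness, no real intersection, `k ⊆ L_{i₁}` allowed).
§2 dresses this on abelian varieties: **`hodgeConjectureFor_prod_pairFlipSextic_of_isNondegenerate`** (the Hodge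
conjecture and `B• = D•` on every `⨁_{j<N} A_{π j}`), and for two SIMPLE CM THREEFOLDS
**`isNondegenerateFamily_pairFlipSextic_simpleThreefold_of_quadratic`** /
**`hodgeConjectureFor_prod_pairFlipSextic_simpleThreefold_of_quadratic`**: a simple CM threefold with a pair-flip
field times ANY simple CM threefold whose field contains an imaginary quadratic field is stably nondegenerate — the
Hodge conjecture holds on all their products, UNCONDITIONALLY.  For `[L_{i₁} : ℚ] ∈ {24, 48}` feed
`GenericCMField.pairFlip_of_finrank_normalClosure` (`CorCM/SexticCMFieldPairFlip`) into `hflip`.  (The remaining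
partner — another pair-flip sextic field — is the sequel `CorCM/GenericSexticThreefoldPairsHodge`.)

## References

* [Gordon1999HodgeAVSurvey] B. B. Gordon, *A survey of the Hodge conjecture for abelian varieties*, §3 Theorem, 7.4–7.7,
  10.10; Ribet's bound (3.7).
* [Dodson1984] B. Dodson, *The structure of Galois groups of CM-fields*, Trans. AMS 283 (1984), §5.1.2.
* [MoonenZarhin1999LowDim] B. Moonen, Yu. Zarhin, *Hodge classes on abelian varieties of low dimension*, Math. Ann.
  315 (1999), Cor. (3.9).
-/

noncomputable section

open CategoryTheory CategoryTheory.Limits NumberField Module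

namespace Summit.HodgeConjecture.CorCM

open Literature.NumberTheory.ComplexMultiplication
open Literature.AlgebraicGeometry.Motives (AbelianVariety CMType)
open Literature.AlgebraicGeometry.HodgeTheory
open Literature.AlgebraicGeometry.ComplexMultiplication (IsCMTypeRealisation isSimple_iff_isPrimitive)
open Literature.AlgebraicGeometry.VanGeemen1994 (hodgeClassSpan)
open Literature.AlgebraicGeometry.Pohlmann1968
open Literature.Barriers.HodgeConjecture (divisorClassesSpan)

variable {I : Type} {K : I → Type} [∀ i, Field (K i)] [∀ i, NumberField (K i)] [∀ i, IsCMField (K i)] [Fintype I]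
  [DecidableEq I] {Φ : ∀ i, CMType (K i)}

/-! ## §0 The two slots: dimensions of `U`, irreducibility, the eigenline -/

section Slots

omit [Fintype I] [DecidableEq I] in
/-- `dim U(Φ_i) ≤ [K_i : ℚ]/2` for every CM type. [cite: Gordon1999HodgeAVSurvey, 7.7] -/
theorem finrank_antiSpan_le_finrank_div_two (i : I) :
    finrank ℚ (antiSpan (ℂ ≃+* ℂ) (Φ i).1) ≤ finrank ℚ (K i) / 2 := by
  have h1 : typeRank (ℂ ≃+* ℂ) (Φ i).1 ≤ Fintype.card (K i →+* ℂ) / 2 + 1 :=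
    (isCMTypeWith_conj (Φ i)).typeRank_le
  have h2 : typeRank (ℂ ≃+* ℂ) (Φ i).1 = finrank ℚ (antiSpan (ℂ ≃+* ℂ) (Φ i).1) + 1 :=
    (isCMTypeWith_conj (Φ i)).typeRank_eq_finrank_antiSpan_add_one
  rw [Embeddings.card] at h1
  omega

omit [Fintype I] [DecidableEq I] in
/-- `dim U(Φ_i) = [K_i : ℚ]/2` iff `Φ_i` is nondegenerate. [cite: Gordon1999HodgeAVSurvey, 7.5 (3)] -/
theorem finrank_antiSpan_eq_iff_isNondegenerate (i : I) :
    finrank ℚ (antiSpan (ℂ ≃+* ℂ) (Φ i).1) = finrank ℚ (K i) / 2 ↔ IsNondegenerate (Φ i) := by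
  have h2 : typeRank (ℂ ≃+* ℂ) (Φ i).1 = finrank ℚ (antiSpan (ℂ ≃+* ℂ) (Φ i).1) + 1 :=
    (isCMTypeWith_conj (Φ i)).typeRank_eq_finrank_antiSpan_add_one
  rw [isNondegenerate_iff, cmTypeRank, h2]
  omega

omit [Fintype I] [DecidableEq I] in
/-- **A pair-flip slot: `U(Φ_{i₁})` is irreducible and of dimension `[K_{i₁} : ℚ]/2`, and `Φ_{i₁}` is nondegenerate.**
[cite: Dodson1984, §5.1.2 Theorem] -/
theorem irreducible_and_finrank_eq_of_pairFlip {i₁ : I}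
    (hflip : ∀ s : K i₁ →+* ℂ, ∃ σ : ℂ ≃+* ℂ, σ • s = (starRingAut : ℂ ≃+* ℂ) • s ∧
      ∀ t : K i₁ →+* ℂ, t ≠ s → t ≠ (starRingAut : ℂ ≃+* ℂ) • s → σ • t = t) :
    (∀ W : Submodule ℚ ((K i₁ →+* ℂ) → ℚ), W ≤ antiSpan (ℂ ≃+* ℂ) (Φ i₁).1 → W ≠ ⊥ →
      (∀ (k : ℂ ≃+* ℂ) (f : (K i₁ →+* ℂ) → ℚ), f ∈ W → (fun y => f (k • y)) ∈ W) →
        W = antiSpan (ℂ ≃+* ℂ) (Φ i₁).1) ∧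
    finrank ℚ (antiSpan (ℂ ≃+* ℂ) (Φ i₁).1) = finrank ℚ (K i₁) / 2 ∧ IsNondegenerate (Φ i₁) := by
  classical
  haveI := isPretransitive_ringEquiv_complex (K := K i₁)
  have hnd : IsNondegenerate (Φ i₁) := by
    rw [isNondegenerate_iff, cmTypeRank, ← Embeddings.card (K i₁) ℂ]
    exact typeRank_eq_of_pairFlip (isCMTypeWith_conj (Φ i₁)) hflip
  exact ⟨antiSpan_irreducible_of_pairFlip (isCMTypeWith_conj (Φ i₁)) hflip,
    (finrank_antiSpan_eq_iff_isNondegenerate i₁).2 hnd, hnd⟩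

omit [Fintype I] [DecidableEq I] in
open scoped Classical in
/-- **The `k`-sign eigenline.**  If an imaginary quadratic field `k` embeds in `K_{i₀}` and `dim U(Φ_{i₀}) =
[K_{i₀} : ℚ]/2 ≥ 2`, then `U(Φ_{i₀})` (= all odd weights) contains the proper non-zero `Aut(ℂ)`-stable line spanned
by the `k`-sign vector `φ ↦ ±1` (`φ|_k = ι₀` or `ῑ₀`). [cite: Gordon1999HodgeAVSurvey, §3 Theorem (proof)] -/
theorem exists_proper_stable_of_quadratic {i₀ : I} {k : Type} [Field k] [NumberField k] [IsTotallyComplex k]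
    (hk : finrank ℚ k = 2) (j : k →+* K i₀) (h2 : 2 ≤ finrank ℚ (K i₀) / 2)
    (hdim : finrank ℚ (antiSpan (ℂ ≃+* ℂ) (Φ i₀).1) = finrank ℚ (K i₀) / 2) :
    ∃ W : Submodule ℚ ((K i₀ →+* ℂ) → ℚ), W ≤ antiSpan (ℂ ≃+* ℂ) (Φ i₀).1 ∧ W ≠ ⊥ ∧
      W ≠ antiSpan (ℂ ≃+* ℂ) (Φ i₀).1 ∧
      ∀ (g : ℂ ≃+* ℂ) (f : (K i₀ →+* ℂ) → ℚ), f ∈ W → (fun y => f (g • y)) ∈ W := by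
  obtain ⟨ι₀⟩ : Nonempty (k →+* ℂ) := inferInstance
  have hU : antiSpan (ℂ ≃+* ℂ) (Φ i₀).1 = antiWeights (E := K i₀ →+* ℂ) (starRingAut : ℂ ≃+* ℂ) := by
    refine (isCMTypeWith_conj (Φ i₀)).typeRank_eq_iff_antiSpan_eq.1 ?_
    rw [(isCMTypeWith_conj (Φ i₀)).typeRank_eq_finrank_antiSpan_add_one, hdim, Embeddings.card]
  -- the `k`-sign vector
  set e : (K i₀ →+* ℂ) → ℚ := fun φ => if φ.comp j = ι₀ then (1 : ℚ) else -1 with he_def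
  have hstar : (starRingAut : ℂ ≃+* ℂ) • ι₀ ≠ ι₀ := fun h => by
    rw [conj_smul_eq_conjugate] at h
    exact IsTotallyComplex.complexEmbedding_not_isReal ι₀ (ComplexEmbedding.isReal_iff.2 h)
  have he_mem : e ∈ antiSpan (ℂ ≃+* ℂ) (Φ i₀).1 := by
    rw [hU, mem_antiWeights_iff']
    intro φ
    have h1 := ksign_smul hk ι₀ j (starRingAut : ℂ ≃+* ℂ) φ
    rw [if_neg hstar] at h1
    show (if ((starRingAut : ℂ ≃+* ℂ) • φ).comp j = ι₀ then (1 : ℚ) else -1) =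
      -(if φ.comp j = ι₀ then (1 : ℚ) else -1)
    rw [h1]
    ring
  have he0 : e ≠ 0 := fun h => by
    have h1 := congrFun h (Classical.arbitrary _)
    simp only [he_def, Pi.zero_apply] at h1
    split_ifs at h1 <;> norm_num at h1
  have heig : ∀ g : ℂ ≃+* ℂ, ∃ c : ℚ, (fun y => e (g • y)) = c • e := fun g =>
    ⟨if g • ι₀ = ι₀ then (1 : ℚ) else -1, funext fun φ => by
      rw [Pi.smul_apply, smul_eq_mul]
      exact ksign_smul hk ι₀ j g φ⟩
  exact exists_proper_stable_of_eigenvector (G := ℂ ≃+* ℂ) he_mem he0 heig (by rw [hdim]; exact h2)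

end Slots

/-! ## §1 Types: the family is nondegenerate iff the partner type is -/

section Types

variable [Nonempty I]

/-- **Pair-flip sextic slot times a CM field of degree `≤ 4`: no common constituent, so the pair is nondegenerate iff
the partner type is** (`U(Φ_{i₁})` irreducible of dimension `3 > 2 ≥ dim U(Φ_{i₀})`).  E.g. a CM threefold with CM by a
sextic field of Galois closure `24`/`48` times ANY CM elliptic curve or CM abelian surface.
[cite: Gordon1999HodgeAVSurvey, §3 Theorem and 7.5–7.7] [cite: Dodson1984, §5.1.2 Theorem] -/
theorem isNondegenerateFamily_iff_pairFlipSextic_of_finrank_le_four {i₀ i₁ : I} (h01 : i₀ ≠ i₁)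
    (hI : ∀ j, j = i₀ ∨ j = i₁)
    (hflip : ∀ s : K i₁ →+* ℂ, ∃ σ : ℂ ≃+* ℂ, σ • s = (starRingAut : ℂ ≃+* ℂ) • s ∧
      ∀ t : K i₁ →+* ℂ, t ≠ s → t ≠ (starRingAut : ℂ ≃+* ℂ) • s → σ • t = t)
    (h6 : finrank ℚ (K i₁) = 6) (h4 : finrank ℚ (K i₀) ≤ 4) :
    CMAlgebra.IsNondegenerateFamily Φ ↔ IsNondegenerate (Φ i₀) := by
  obtain ⟨hirr, hdim₁, hnd₁⟩ := irreducible_and_finrank_eq_of_pairFlip (Φ := Φ) hflip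
  have hle₀ := finrank_antiSpan_le_finrank_div_two (Φ := Φ) i₀
  have hp := pairwise_of_irreducible_of_finrank_le (G := ℂ ≃+* ℂ) (Φ := fun i => (Φ i).1) (i := i₀) (j := i₁)
    hirr (by rw [hdim₁, h6]; omega) (fun h => by rw [hdim₁, h6] at h; omega)
  rw [isNondegenerateFamily_iff_forall_of_pairwise Φ fun i j hij => ?_]
  · exact ⟨fun h => h i₀, fun h i => by rcases hI i with rfl | rfl <;> assumption⟩
  · rcases hI i with rfl | rfl <;> rcases hI j with rfl | rfl
    · exact absurd rfl hij
    · exact hp.1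
    · exact hp.2
    · exact absurd rfl hij

/-- **Pair-flip sextic slot times a sextic CM field containing an imaginary quadratic field `k`: no common
constituent, so the pair is nondegenerate iff the partner type is** (`U(Φ_{i₁})` irreducible; if `U(Φ_{i₀})` is
three-dimensional it contains the `k`-sign line).  E.g. a CM threefold with CM by a sextic field of Galois closure
`24`/`48` times ANY CM threefold with CM by a cyclic sextic `k·C` or a non-Galois `K⁺·k` — no condition relating the
fields (`k` may well lie in the Galois closure of `K_{i₁}`). [cite: Gordon1999HodgeAVSurvey, §3 Theorem and 7.5–7.7]
[cite: Dodson1984, §5.1.2 Theorem] -/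
theorem isNondegenerateFamily_iff_pairFlipSextic_of_quadratic {i₀ i₁ : I} (h01 : i₀ ≠ i₁)
    (hI : ∀ j, j = i₀ ∨ j = i₁)
    (hflip : ∀ s : K i₁ →+* ℂ, ∃ σ : ℂ ≃+* ℂ, σ • s = (starRingAut : ℂ ≃+* ℂ) • s ∧
      ∀ t : K i₁ →+* ℂ, t ≠ s → t ≠ (starRingAut : ℂ ≃+* ℂ) • s → σ • t = t)
    (h6 : finrank ℚ (K i₁) = 6) (h6₀ : finrank ℚ (K i₀) = 6) {k : Type} [Field k] [NumberField k]
    [IsTotallyComplex k] (hk : finrank ℚ k = 2) (jk : k →+* K i₀) :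
    CMAlgebra.IsNondegenerateFamily Φ ↔ IsNondegenerate (Φ i₀) := by
  obtain ⟨hirr, hdim₁, hnd₁⟩ := irreducible_and_finrank_eq_of_pairFlip (Φ := Φ) hflip
  have hle₀ := finrank_antiSpan_le_finrank_div_two (Φ := Φ) i₀
  have hp := pairwise_of_irreducible_of_finrank_le (G := ℂ ≃+* ℂ) (Φ := fun i => (Φ i).1) (i := i₀) (j := i₁)
    hirr (by rw [hdim₁, h6]; omega) (fun h => by
      rw [hdim₁, h6] at h
      exact exists_proper_stable_of_quadratic (Φ := Φ) hk jk (by omega) (by omega))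
  rw [isNondegenerateFamily_iff_forall_of_pairwise Φ fun i j hij => ?_]
  · exact ⟨fun h => h i₀, fun h i => by rcases hI i with rfl | rfl <;> assumption⟩
  · rcases hI i with rfl | rfl <;> rcases hI j with rfl | rfl
    · exact absurd rfl hij
    · exact hp.1
    · exact hp.2
    · exact absurd rfl hij

end Types

/-! ## §2 Abelian varieties -/

section Geometry

variable [Nonempty I] {A : I → AbelianVariety ℂ} {ι : ∀ i, 𝓞 (K i) →+* End (A i)}
  {θ : ∀ i, K i →+* Module.End ℂ (complexBetti (A i).X 1)}

/-- **The Hodge conjecture on every `A₀^a × A₁^b`** (every `⨁_{j<N} A_{π j}`), with `B• = D•` there, for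
realisations of a NONDEGENERATE type `Φ_{i₀}` of a CM field of degree `≤ 4` (any CM elliptic curve, any simple CM
abelian surface) and any type of a sextic CM field with pair flips — UNCONDITIONAL.
[cite: Gordon1999HodgeAVSurvey, §3 Theorem and 10.10] -/
theorem hodgeConjectureFor_prod_pairFlipSextic_of_finrank_le_four {i₀ i₁ : I} (h01 : i₀ ≠ i₁)
    (hI : ∀ j, j = i₀ ∨ j = i₁)
    (hflip : ∀ s : K i₁ →+* ℂ, ∃ σ : ℂ ≃+* ℂ, σ • s = (starRingAut : ℂ ≃+* ℂ) • s ∧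
      ∀ t : K i₁ →+* ℂ, t ≠ s → t ≠ (starRingAut : ℂ ≃+* ℂ) • s → σ • t = t)
    (h6 : finrank ℚ (K i₁) = 6) (h4 : finrank ℚ (K i₀) ≤ 4) (hnd : IsNondegenerate (Φ i₀))
    (hA : ∀ i, IsCMTypeRealisation (Φ i) (A i) (ι i) (θ i)) {N : ℕ} (π : Fin N → I) :
    HodgeConjectureFor (⨁ fun j : Fin N => A (π j)).dim (⨁ fun j : Fin N => A (π j)).X ∧
      ∀ m : ℕ, hodgeClassSpan (⨁ fun j : Fin N => A (π j)).dim (⨁ fun j : Fin N => A (π j)).X m =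
        divisorClassesSpan (⨁ fun j : Fin N => A (π j)).X (⨁ fun j : Fin N => A (π j)).dim m :=
  have h := (isNondegenerateFamily_iff_pairFlipSextic_of_finrank_le_four h01 hI hflip h6 h4).2 hnd
  ⟨h.hodgeConjectureFor_prod hA π, fun m => h.hodgeClassSpan_prod_eq_divisorClassesSpan hA π m⟩

/-- **The Hodge conjecture on every `A₀^a × A₁^b`**, with `B• = D•` there, for realisations of a NONDEGENERATE type
`Φ_{i₀}` of a sextic CM field receiving an imaginary quadratic field and any type of a sextic CM field with pair flips —
UNCONDITIONAL. [cite: Gordon1999HodgeAVSurvey, §3 Theorem and 10.10] -/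
theorem hodgeConjectureFor_prod_pairFlipSextic_of_quadratic {i₀ i₁ : I} (h01 : i₀ ≠ i₁)
    (hI : ∀ j, j = i₀ ∨ j = i₁)
    (hflip : ∀ s : K i₁ →+* ℂ, ∃ σ : ℂ ≃+* ℂ, σ • s = (starRingAut : ℂ ≃+* ℂ) • s ∧
      ∀ t : K i₁ →+* ℂ, t ≠ s → t ≠ (starRingAut : ℂ ≃+* ℂ) • s → σ • t = t)
    (h6 : finrank ℚ (K i₁) = 6) (h6₀ : finrank ℚ (K i₀) = 6) {k : Type} [Field k] [NumberField k]
    [IsTotallyComplex k] (hk : finrank ℚ k = 2) (j : k →+* K i₀) (hnd : IsNondegenerate (Φ i₀))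
    (hA : ∀ i, IsCMTypeRealisation (Φ i) (A i) (ι i) (θ i)) {N : ℕ} (π : Fin N → I) :
    HodgeConjectureFor (⨁ fun j : Fin N => A (π j)).dim (⨁ fun j : Fin N => A (π j)).X ∧
      ∀ m : ℕ, hodgeClassSpan (⨁ fun j : Fin N => A (π j)).dim (⨁ fun j : Fin N => A (π j)).X m =
        divisorClassesSpan (⨁ fun j : Fin N => A (π j)).X (⨁ fun j : Fin N => A (π j)).dim m :=
  have h := (isNondegenerateFamily_iff_pairFlipSextic_of_quadratic h01 hI hflip h6 h6₀ hk j).2 hnd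
  ⟨h.hodgeConjectureFor_prod hA π, fun m => h.hodgeClassSpan_prod_eq_divisorClassesSpan hA π m⟩

/-- **Two simple CM threefolds, one field with pair flips, the other containing an imaginary quadratic field: the pair
is nondegenerate** (`Hg(A₀ × A₁) = Hg(A₀) × Hg(A₁)`), whatever the types — primitive sextic types are nondegenerate
(Ribet's bound) and the pair has no common constituent. [cite: Gordon1999HodgeAVSurvey, 7.5–7.7 and (3.7)]
[cite: Dodson1984, §5.1.2 Theorem] -/
theorem isNondegenerateFamily_pairFlipSextic_simpleThreefold_of_quadratic {i₀ i₁ : I} (h01 : i₀ ≠ i₁)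
    (hI : ∀ j, j = i₀ ∨ j = i₁)
    (hflip : ∀ s : K i₁ →+* ℂ, ∃ σ : ℂ ≃+* ℂ, σ • s = (starRingAut : ℂ ≃+* ℂ) • s ∧
      ∀ t : K i₁ →+* ℂ, t ≠ s → t ≠ (starRingAut : ℂ ≃+* ℂ) • s → σ • t = t)
    (h6 : ∀ i, finrank ℚ (K i) = 6) {k : Type} [Field k] [NumberField k] [IsTotallyComplex k]
    (hk : finrank ℚ k = 2) (j : k →+* K i₀) (hA : ∀ i, IsCMTypeRealisation (Φ i) (A i) (ι i) (θ i))
    (hS : (A i₀).IsSimple) : CMAlgebra.IsNondegenerateFamily Φ :=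
  (isNondegenerateFamily_iff_pairFlipSextic_of_quadratic h01 hI hflip (h6 i₁) (h6 i₀) hk j).2
    (isNondegenerate_of_isSimple_of_finrank_eq_six (h6 i₀) (hA i₀) hS)

/-- **The Hodge conjecture on every `A₀^a × A₁^b` of two simple CM abelian threefolds, one with CM by a sextic field
with pair flips, the other with CM by a sextic field containing an imaginary quadratic field** (cyclic `k·C`, or
`K⁺·k` with non-Galois cubic `K⁺`), with `B• = D•` there — UNCONDITIONAL, no condition relating the two fields.
[cite: Gordon1999HodgeAVSurvey, §3 Theorem, 7.5 and 10.10] [cite: Dodson1984, §5.1.2 Theorem] -/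
theorem hodgeConjectureFor_prod_pairFlipSextic_simpleThreefold_of_quadratic {i₀ i₁ : I} (h01 : i₀ ≠ i₁)
    (hI : ∀ j, j = i₀ ∨ j = i₁)
    (hflip : ∀ s : K i₁ →+* ℂ, ∃ σ : ℂ ≃+* ℂ, σ • s = (starRingAut : ℂ ≃+* ℂ) • s ∧
      ∀ t : K i₁ →+* ℂ, t ≠ s → t ≠ (starRingAut : ℂ ≃+* ℂ) • s → σ • t = t)
    (h6 : ∀ i, finrank ℚ (K i) = 6) {k : Type} [Field k] [NumberField k] [IsTotallyComplex k]
    (hk : finrank ℚ k = 2) (j : k →+* K i₀) (hA : ∀ i, IsCMTypeRealisation (Φ i) (A i) (ι i) (θ i))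
    (hS : (A i₀).IsSimple) {N : ℕ} (π : Fin N → I) :
    HodgeConjectureFor (⨁ fun j : Fin N => A (π j)).dim (⨁ fun j : Fin N => A (π j)).X ∧
      ∀ m : ℕ, hodgeClassSpan (⨁ fun j : Fin N => A (π j)).dim (⨁ fun j : Fin N => A (π j)).X m =
        divisorClassesSpan (⨁ fun j : Fin N => A (π j)).X (⨁ fun j : Fin N => A (π j)).dim m :=
  have h := isNondegenerateFamily_pairFlipSextic_simpleThreefold_of_quadratic h01 hI hflip h6 hk j hA hS
  ⟨h.hodgeConjectureFor_prod hA π, fun m => h.hodgeClassSpan_prod_eq_divisorClassesSpan hA π m⟩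

/-- **No exceptional Hodge class on any `A₀^a × A₁^b`** in the situation of
`isNondegenerateFamily_pairFlipSextic_simpleThreefold_of_quadratic`. [cite: Gordon1999HodgeAVSurvey, 7.5 and 7.6.1] -/
theorem not_exists_exceptional_prod_pairFlipSextic_simpleThreefold_of_quadratic {i₀ i₁ : I} (h01 : i₀ ≠ i₁)
    (hI : ∀ j, j = i₀ ∨ j = i₁)
    (hflip : ∀ s : K i₁ →+* ℂ, ∃ σ : ℂ ≃+* ℂ, σ • s = (starRingAut : ℂ ≃+* ℂ) • s ∧
      ∀ t : K i₁ →+* ℂ, t ≠ s → t ≠ (starRingAut : ℂ ≃+* ℂ) • s → σ • t = t)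
    (h6 : ∀ i, finrank ℚ (K i) = 6) {k : Type} [Field k] [NumberField k] [IsTotallyComplex k]
    (hk : finrank ℚ k = 2) (j : k →+* K i₀) (hA : ∀ i, IsCMTypeRealisation (Φ i) (A i) (ι i) (θ i))
    (hS : (A i₀).IsSimple) {N : ℕ} (π : Fin N → I) (m : ℕ) :
    ¬∃ c : complexBetti (⨁ fun j : Fin N => A (π j)).X (2 * m), IsRationalClass c ∧
        IsOfHodgeType (⨁ fun j : Fin N => A (π j)).dim (⨁ fun j : Fin N => A (π j)).X (2 * m) m m c ∧
        c ∉ divisorClassesSpan (⨁ fun j : Fin N => A (π j)).X (⨁ fun j : Fin N => A (π j)).dim m :=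
  (isNondegenerateFamily_pairFlipSextic_simpleThreefold_of_quadratic h01 hI hflip h6 hk j hA hS).not_exists_exceptional_prod
    hA π m

/-- **A CM elliptic curve or a SIMPLE CM abelian surface times a CM threefold with a pair-flip field: the Hodge
conjecture on all `A₀^a × A₁^b`** (types of imaginary quadratic fields and primitive quartic types are nondegenerate).
[cite: Gordon1999HodgeAVSurvey, §3 Theorem, (3.7) and 10.10] [cite: MoonenZarhin1999LowDim, Cor. (3.9)] -/
theorem hodgeConjectureFor_prod_pairFlipSextic_simple_of_finrank_le_four {i₀ i₁ : I} (h01 : i₀ ≠ i₁)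
    (hI : ∀ j, j = i₀ ∨ j = i₁)
    (hflip : ∀ s : K i₁ →+* ℂ, ∃ σ : ℂ ≃+* ℂ, σ • s = (starRingAut : ℂ ≃+* ℂ) • s ∧
      ∀ t : K i₁ →+* ℂ, t ≠ s → t ≠ (starRingAut : ℂ ≃+* ℂ) • s → σ • t = t)
    (h6 : finrank ℚ (K i₁) = 6) (h4 : finrank ℚ (K i₀) ≤ 4)
    (hA : ∀ i, IsCMTypeRealisation (Φ i) (A i) (ι i) (θ i)) (hS : (A i₀).IsSimple) {N : ℕ} (π : Fin N → I) :
    HodgeConjectureFor (⨁ fun j : Fin N => A (π j)).dim (⨁ fun j : Fin N => A (π j)).X ∧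
      ∀ m : ℕ, hodgeClassSpan (⨁ fun j : Fin N => A (π j)).dim (⨁ fun j : Fin N => A (π j)).X m =
        divisorClassesSpan (⨁ fun j : Fin N => A (π j)).X (⨁ fun j : Fin N => A (π j)).dim m := by
  obtain ⟨φ₀⟩ : Nonempty (K i₀ →+* ℂ) := inferInstance
  exact hodgeConjectureFor_prod_pairFlipSextic_of_finrank_le_four h01 hI hflip h6 h4
    (isNondegenerate_of_isPrimitive_of_finrank_le_six (Φ i₀) (by omega) φ₀
      ((isSimple_iff_isPrimitive (hA i₀) φ₀).1 hS)) hA π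

end Geometry


end Summit.HodgeConjecture.CorCM

end
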